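import Summits.BirchSwinnertonDyer.BirchSwinnertonDyer.Theses.AdditiveBranchIMC
import Summits.BirchSwinnertonDyer.BirchSwinnertonDyer.Theorems.AdditiveBranchIMCMultLowerBranchTransportClasses
import Summits.BirchSwinnertonDyer.Rank1Residual.Additive.ChiBranchLowerTransportPotMult
import HarnessLib

/-!
# Route `AdditiveBranchIMC` (rung K1), crux `MultLower` (item `stmt-BirchSwinnertonDyer-19359`):
# the registered stub `stub_rankZero` ISOLATED — what it is, and what it is modulo

The crux `MultLower` = `∀ W p, r_an ≤ 1 → N10.CellM W p → MissingLowerBoundAt W p` (cell (M): odd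
additive `p`, `ord_p j < 0`, `E = V ⊗ χ_{p*}` with `V` multiplicative at `p`); its registered BC3 stubs are
`stub_rankZero` (`r_an = 0`) and `stub_rankOne` (`r_an = 1`), `MultLower_of` composing them
(`Cruxes/MultLower/Lines/birth.lean`, skeleton sha16 185d348c2213f0b0). THIS FILE (theorems only):

* §1 `stub_rankZero_iff_lowerHalfM` — the registered rank-`0` stub IS, verbatim, the tree's conjecture
  `N10.LowerHalfM` (`Additive/N10LowerHalfStatements.lean`, `@[conjecture]`, OPEN, in print as a conjecture
  only: Delbourgo 1998 Main Conjecture p. 151 at `T = 0` under (M)); and `multLower_of_lowerHalfM_of_rankOne`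
  — the skeleton's composition with that name.
* §2 `lowerHalfM_of_facts_of_chiBranchLowerLeadingTerm` — `stub_rankZero` MODULO exactly ONE typed
  `T = 0` object per parity: the Skinner–Urban direction on the `ω^{(p−1)/2}`-branch of the multiplicative
  twist at `T = 0`, `ChiBranchLowerLeadingTermAt W p` (`p ≡ 1 (4)`) / `ChiBranchLowerLeadingTermOddAt W p`
  (`p ≡ 3 (4)`) — n1011-p07's typed inputs — over the published facts `hDelX` (Delbourgo 1998 Prop. 4 +
  §2.2 Lemma (ii), EXACT on (M)), `hPal` (Pal 2012 Thm. 3.2), `hGZK`, `hmod`, `hmodD`, through the tree's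
  end states `ClassX3M/ClassX4M.missingLowerBoundAt_rankZero_of_chiBranchLower[Odd]` and the dictionary
  `N10.cellM_iff_classX3M_or_classX4M`. NO image, anomalous, Tamagawa, Manin or `p ≥ 5` hypothesis.
* §3 the rank-`0` LOWER half on cell (M) from the BRANCH TRANSPORT of
  `AdditiveBranchIMCMultLowerBranchTransport{,Classes}.lean`: (KV) Kato for `V` on the trivial branch +
  (BC) the base-change product bound (NOT in print: `p ∣ d_K`) + ONE unit coefficient of `ϖ·L^±_br`
  (finite `μ = 0` certificate) ⟹ `MissingLowerBoundAt W p` on X4(M) ∩ {ρ̄ onto} (`hK`, Kato 17.4 (3)) and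
  on X3♯(M) (`hW16`, Wuthrich Thm. 16), glued in `missingLowerBoundAt_rankZero_of_cellM_of_katoV_of_baseChangeLower`
  = `stub_rankZero` at every pair of cell (M) whose `ρ̄_{E,p}` is reducible or onto, MODULO (KV), (BC) and
  the certificate.

HONEST LABELS. Nothing here closes the item: §2/§3 are CONDITIONAL class theorems (helpers); the
unconditional `stub_rankZero` is the open problem «Eisenstein lower bound on a non-trivial tame branch of a
multiplicative newform» (RESIDUAL-MAP §I N10; no printed or announced source, cf. the located gap of
`Additive/N10LowerHalfResidue.lean` (b)). Cell (M) stays CONSTRUCTION-shaped; nothing booked; no new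
named fact; every published input is a hypothesis BY NAME.

References: Delbourgo, Compositio Math. 113 (1998) Prop. 4, §2.2 Lemma (ii), Main Conjecture p. 151
[Delbourgo1998]; Pal, Proc. AMS 2012 Thm. 3.2 [Pal2012]; Kato, Astérisque 295 (2004) Thm. 17.4 (3)
[Kato2004Asterisque]; Wuthrich, Doc. Math. 19 (2014) Thm. 16 [Wuthrich2014]; Burungale–Castella–Skinner,
IMRN 2025 Thm. 1.1.2 (a) [BurungaleCastellaSkinner2025]; Miller, LMS J. Comput. Math. 14 (2011) Def. 1.1
[Miller2011LMS].
-/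

set_option autoImplicit false
set_option linter.dupNamespace false

noncomputable section

open scoped Classical MatrixGroups ModularForm

namespace Summit.BirchSwinnertonDyer.BirchSwinnertonDyer.Theorems.AdditiveBranchIMCMultLower

open CongruenceSubgroup WeierstrassCurve Literature.NumberTheory.EllipticCurves
  Literature.NumberTheory.EllipticCurves.ModularForms
  Literature.NumberTheory.EllipticCurves.Rank1Residual
  Literature.NumberTheory.EllipticCurves.Rank1Residual.Typed
  Summit.BirchSwinnertonDyer.Rank1Residual.Additive
  Summit.BirchSwinnertonDyer.Rank1Residual.AdditivePotMult
  Summit.BirchSwinnertonDyer.BirchSwinnertonDyer.Theses.AdditiveBranchIMC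

/-! ### §1 The registered stub `stub_rankZero` is the tree's conjecture `N10.LowerHalfM` -/

/-- **`stub_rankZero` ≡ `N10.LowerHalfM`, verbatim.** The registered rank-`0` stub of the crux
`MultLower` (`∀ W p, r_an = 0 → N10.CellM W p → MissingLowerBoundAt W p`) is, literally, the tree's
`@[conjecture] N10.LowerHalfM` (cell (M) of RESIDUAL-MAP §I N10: the LOWER half `ord_p #Ш_an ≤ ord_p #Ш`
at an odd additive potentially multiplicative prime in analytic rank `0`; in print as a CONJECTURE only —
Delbourgo 1998, Main Conjecture p. 151 at `T = 0` under (M)). Bookkeeping (`Iff.rfl`).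
[cite: Delbourgo1998, Main Conjecture (p. 151), hypothesis (M) (p. 133) (shape only; nothing asserted)] -/
theorem stub_rankZero_iff_lowerHalfM :
    (∀ (W : WeierstrassCurve ℚ) [W.IsElliptic] [W.IsGloballyMinimal] (p : ℕ) [Fact p.Prime],
      W.analyticRank = 0 → N10.CellM W p → MissingLowerBoundAt W p) ↔ N10.LowerHalfM :=
  Iff.rfl

/-- **The crux from the tree's conjecture `N10.LowerHalfM` and the rank-`1` stub** — the BC3 skeleton's
composition `MultLower_of` with the rank-`0` stub spelled by its tree name. [cite: Miller2011LMS, Def. 1.1] -/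
theorem multLower_of_lowerHalfM_of_rankOne (h₀ : N10.LowerHalfM)
    (h₁ : ∀ (W : WeierstrassCurve ℚ) [W.IsElliptic] [W.IsGloballyMinimal] (p : ℕ) [Fact p.Prime],
      W.analyticRank = 1 → N10.CellM W p → MissingLowerBoundAt W p) :
    Summit.BirchSwinnertonDyer.BirchSwinnertonDyer.Theses.AdditiveBranchIMC.MultLower := by
  intro W _ _ p _ hr hc
  rcases Nat.le_one_iff_eq_zero_or_eq_one.mp hr with h | h
  · exact h₀ W p h hc
  · exact h₁ W p h hc

/-! ### §2 `stub_rankZero` modulo the ONE typed `T = 0` input per parity -/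

/-- **`stub_rankZero` (= `N10.LowerHalfM`) from the `χ`-branch lower input at `T = 0`.** Granted the
published facts — Delbourgo 1998 Prop. 4 + §2.2 Lemma (ii) on (M) in exact unit form (`hDelX`), Pal 2012
Thm. 3.2 (`hPal`, `p ≡ 1 (4)`), Gross–Zagier–Kolyvagin (`hGZK`), modularity (`hmod`), a modular
parametrisation (`hmodD`) — IF at every pair of cell (M) in analytic rank `0` the Skinner–Urban direction on
the `ω^{(p−1)/2}`-branch of the multiplicative twist holds at `T = 0` in the typed form of the parity
(`ChiBranchLowerLeadingTermAt W p` for `p ≡ 1 (4)`, `ChiBranchLowerLeadingTermOddAt W p` for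
`p ≡ 3 (4)`; n1011-p07, `Additive/ChiBranchLowerInput.lean` — NOT in print at any pair), THEN the rank-`0`
stub of the crux holds. Assembly over `N10.cellM_iff_classX3M_or_classX4M` and the tree's end states
`ClassX3M/ClassX4M.missingLowerBoundAt_rankZero_of_chiBranchLower[Odd]`. Conditional; cell (M) stays
CONSTRUCTION-shaped; nothing booked. [cite: Delbourgo1998, Prop. 4 (p. 144), §2.2 Lemma (ii) (p. 139)]
[cite: Pal2012, Thm. 3.2] [cite: Miller2011LMS, Def. 1.1] -/
theorem lowerHalfM_of_facts_of_chiBranchLowerLeadingTerm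
    (hDelX : Delbourgo1998.prop4_rankZero_constantCoeff_eq_unit_mul_of_potMult)
    (hPal : Pal2012.thm32_sqrt_mul_realPeriodRat_twist_eq_of_prime_one_mod_four)
    (hGZK : rank_eq_analyticRank_of_analyticRank_le_one) (hmod : hasEntireLFunction_rat)
    (hmodD : nonempty_modularParametrizationData)
    (hLow : ∀ (W : WeierstrassCurve ℚ) [W.IsElliptic] [W.IsGloballyMinimal] (p : ℕ) [Fact p.Prime],
      N10.CellM W p → W.analyticRank = 0 →
        (p % 4 = 1 → ChiBranchLowerLeadingTermAt W p) ∧ (p % 4 = 3 → ChiBranchLowerLeadingTermOddAt W p)) :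
    N10.LowerHalfM := by
  intro W _ _ p _ hr hc
  obtain ⟨h1, h3⟩ := hLow W p hc hr
  have hodd : p % 4 = 1 ∨ p % 4 = 3 := by
    obtain ⟨k, hk⟩ := (Fact.out : p.Prime).odd_of_ne_two hc.1
    omega
  rcases (N10.cellM_iff_classX3M_or_classX4M W p).mp hc with hX | hX
  · rcases hodd with h | h
    · exact hX.missingLowerBoundAt_rankZero_of_chiBranchLower hDelX hPal hGZK hmod hmodD h hr (h1 h)
    · exact hX.missingLowerBoundAt_rankZero_of_chiBranchLowerOdd hDelX hGZK hmod hmodD h hr (h3 h)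
  · rcases hodd with h | h
    · exact hX.missingLowerBoundAt_rankZero_of_chiBranchLower hDelX hPal hGZK hmod hmodD h hr (h1 h)
    · exact hX.missingLowerBoundAt_rankZero_of_chiBranchLowerOdd hDelX hGZK hmod hmodD h hr (h3 h)

variable (p : ℕ) [hp : Fact p.Prime]

/-! ### §3 Rank `0` on cell (M) from the BRANCH TRANSPORT: (KV) + (BC) + ONE unit coefficient -/

/-- **X4(M) ∩ {ρ̄ onto}, `r_an = 0`, EVERY odd `p`: the LOWER half `ord_p #Ш(E)_an ≤ ord_p #Ш(E)`
(`Typed.MissingLowerBoundAt W p` = the crux's `stub_rankZero` at the pair) from (KV) + (BC) + the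
unit-coefficient certificate of the relevant parity**, over the published facts `hDelX` (Delbourgo 1998
Prop. 4 + §2.2 Lemma (ii), exact on (M)), `hPal` (Pal 2012 Thm. 3.2, used at `p ≡ 1 (4)` only), `hGZK`,
`hmod`, `hmodD`, `hK` (Kato 17.4 (3) reading). Chain: §4 ⟹ `ChiBranchRatCharEqMult[Odd]At W p` ⟹ the
tree's `ClassX4M.missingLowerBoundAt_rankZero_of_ratCharEqMult[Odd]_of_unitCoeff`. NO anomalous /
`p ≥ 5` / Tamagawa / Manin hypothesis. X4(M) stays CONSTRUCTION-shaped ((BC) is not in print); nothing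
booked. [cite: Delbourgo1998, Prop. 4 (p. 144), §2.2 Lemma (ii) (p. 139)] [cite: Pal2012, Thm. 3.2]
[cite: Kato2004Asterisque, Thm. 17.4 (3) (p. 273)] [cite: BurungaleCastellaSkinner2025, Thm. 1.1.2 (a) (shape)] -/
theorem ClassX4M.missingLowerBoundAt_rankZero_of_katoV_of_baseChangeLower_of_unitCoeff
    {W : WeierstrassCurve ℚ} [W.IsElliptic] [W.IsGloballyMinimal]
    (hDelX : Delbourgo1998.prop4_rankZero_constantCoeff_eq_unit_mul_of_potMult)
    (hPal : Pal2012.thm32_sqrt_mul_realPeriodRat_twist_eq_of_prime_one_mod_four)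
    (hGZK : rank_eq_analyticRank_of_analyticRank_le_one) (hmod : hasEntireLFunction_rat)
    (hmodD : nonempty_modularParametrizationData)
    (hK : Wuthrich2014.kato_halfEigenCharIdeal_dvd_cyclotomicPrime_of_surjective)
    (hX : ClassX4M W p) (hsurj : Surj W p) (hr : W.analyticRank = 0)
    (hKV : ∀ (V : WeierstrassCurve ℚ) [V.IsElliptic] [V.IsGloballyMinimal] (C : VariableChange ℚ),
      Mult V p → C • V.quadraticTwist ((-1 : ℚ) ^ (p / 2) * p) = W →
      ∀ {N : ℕ} [NeZero N] (f : CuspForm (Gamma0 N) 2), IsNewformOf V f →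
      ∀ (ap : ℤ), cuspCoeff f p = ap →
      ∀ (κ : ZpExtension ℚ p) (γ : Field.absoluteGaloisGroup ℚ),
        κ.IsCyclotomic → κ.IsTopGenerator γ → IsCyclotomicVariable p γ →
      ∀ (DV : V.SelmerDualData κ γ) (L : PowerSeries ℚ_[p]),
        IsMultPAdicLFunctionOf f p ((ap : ℤ) : ℚ_[p]) L →
        ∃ (a : ℕ) (h : IwasawaAlgebra p), h ∈ DV.charIdeal ∧
          iwasawaToPowerSeries p
              (PowerSeries.X ^ (if V.HasSplitMultiplicativeReductionAtPrime p then 1 else 0) * h) =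
            PowerSeries.C ((p : ℚ_[p]) ^ a) * L)
    (hBC : ∀ (V : WeierstrassCurve ℚ) [V.IsElliptic] [V.IsGloballyMinimal] (C : VariableChange ℚ),
      Mult V p → C • V.quadraticTwist ((-1 : ℚ) ^ (p / 2) * p) = W →
      ∀ {N : ℕ} [NeZero N] (f : CuspForm (Gamma0 N) 2), IsNewformOf V f →
      ∀ (ap : ℤ), cuspCoeff f p = ap →
      ∀ (κ : ZpExtension ℚ p) (γ : Field.absoluteGaloisGroup ℚ),
        κ.IsCyclotomic → κ.IsTopGenerator γ → IsCyclotomicVariable p γ →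
      ∀ (DV : V.SelmerDualData κ γ) (D : W.SelmerDualData κ γ) (L : PowerSeries ℚ_[p]),
        IsMultPAdicLFunctionOf f p ((ap : ℤ) : ℚ_[p]) L →
        ∃ (m n : ℕ) (G : IwasawaAlgebra p),
          iwasawaToPowerSeries p
              (PowerSeries.X ^ (if V.HasSplitMultiplicativeReductionAtPrime p then 1 else 0) * G) =
            PowerSeries.C ((p : ℚ_[p]) ^ n) *
              (L * (if Even (p / 2) then padicLFunctionPlusBranchMult f ((ap : ℤ) : ℚ_[p]) (p / 2)
                else padicLFunctionMinusBranchMult f ((ap : ℤ) : ℚ_[p]) (p / 2))) ∧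
          ∀ x ∈ DV.charIdeal, ∀ y ∈ D.charIdeal,
            PowerSeries.C ((p : ℤ_[p]) ^ m) * (x * y) ∈ Ideal.span {G})
    (hcert₁ : p % 4 = 1 → MultBranchUnitCoeffCert W p)
    (hcert₃ : p % 4 = 3 → MultOddBranchUnitCoeffCert W p) : MissingLowerBoundAt W p := by
  obtain ⟨h1, h3⟩ := ClassX4M.chiBranchRatCharEqMult_of_katoV_of_baseChangeLower p hK hX hsurj hKV hBC
  have hodd : p % 4 = 1 ∨ p % 4 = 3 := by
    obtain ⟨k, hk⟩ := hp.out.odd_of_ne_two hX.p_ne_two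
    omega
  rcases hodd with h | h
  · exact hX.missingLowerBoundAt_rankZero_of_ratCharEqMult_of_unitCoeff hDelX hPal hGZK hmod hmodD h hr
      (h1 h) (hcert₁ h)
  · exact hX.missingLowerBoundAt_rankZero_of_ratCharEqMultOdd_of_unitCoeff hDelX hGZK hmod hmodD h hr
      (h3 h) (hcert₃ h)

/-- X3♯(M), `p ≡ 1 (mod 4)`: the integral lower divisibility at `T = 0` (`CycLowerLeadingTermAt W p`) from
the rational branch main conjecture of the multiplicative twist and the certificate — the X3♯ twin of the
tree's `ClassX4M.cycLowerLeadingTermAt_of_ratCharEqMult_of_unitCoeff` (twist model by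
`ClassX3M.exists_mult_pStar_twist_model`; no image hypothesis anywhere).
[cite: MazurTateTeitelbaum1986Invent, §I.14] [cite: Pal2012, Thm. 3.2] -/
theorem ClassX3M.cycLowerLeadingTermAt_of_ratCharEqMult_of_unitCoeff
    {W : WeierstrassCurve ℚ} [W.IsElliptic] [W.IsGloballyMinimal]
    (hPal : Pal2012.thm32_sqrt_mul_realPeriodRat_twist_eq_of_prime_one_mod_four)
    (hmod : hasEntireLFunction_rat) (hmodD : nonempty_modularParametrizationData)
    (hX : ClassX3M W p) (hp4 : p % 4 = 1) (hMC : ChiBranchRatCharEqMultAt W p)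
    (hcert : MultBranchUnitCoeffCert W p) : CycLowerLeadingTermAt W p := by
  obtain ⟨V, iV, iVm, C, hV, hC⟩ := hX.exists_mult_pStar_twist_model
  haveI : NeZero (V.conductorNorm ℤ) := ⟨(V.conductorNorm_pos_holds).ne'⟩
  obtain ⟨Dm⟩ := hmodD V
  obtain ⟨ϖ, -, hϖ, -⟩ := Dm.exists_rat_mul_realPeriodRat_eq_plusPeriod
  have hC' : C • V.quadraticTwist (p : ℚ) = W := by
    rw [pStar_eq_of_mod_four p (Or.inl hp4), if_pos hp4] at hC
    exact hC
  by_cases hs : V.HasSplitMultiplicativeReductionAtPrime p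
  · obtain ⟨hap, -⟩ := Dm.isNewformOf.cuspCoeff_eq_one_and_sq_of_split hs
    have hap' : cuspCoeff Dm.f p = ((1 : ℤ) : ℂ) := by exact_mod_cast hap
    exact cycLowerLeadingTermAt_of_chiBranchRatCharEqMult_of_unitCoeff W p hPal hmod hp4 hX.1.2 V
      ⟨C, hC'⟩ hV Dm.isNewformOf (Dm.isNewformOf.dvd_level_of_split hs) hap' (Or.inl rfl) ϖ hϖ hMC
      (hcert V C hV hC' Dm.f Dm.isNewformOf 1 hap' ϖ hϖ)
  · obtain ⟨hap, hpN⟩ := Dm.isNewformOf.cuspCoeff_eq_neg_one_and_dvd_of_nonsplit hV hs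
    have hap' : cuspCoeff Dm.f p = ((-1 : ℤ) : ℂ) := by exact_mod_cast hap
    exact cycLowerLeadingTermAt_of_chiBranchRatCharEqMult_of_unitCoeff W p hPal hmod hp4 hX.1.2 V
      ⟨C, hC'⟩ hV Dm.isNewformOf hpN hap' (Or.inr rfl) ϖ hϖ hMC
      (hcert V C hV hC' Dm.f Dm.isNewformOf (-1) hap' ϖ hϖ)

/-- X3♯(M), `p ≡ 3 (mod 4)` (`p = 3` included): the X3♯ twin of
`ClassX4M.cycLowerLeadingTermAt_of_ratCharEqMultOdd_of_unitCoeff` (Pal for `d < 0` PROVED in the tree).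
[cite: MazurTateTeitelbaum1986Invent, §I.14] -/
theorem ClassX3M.cycLowerLeadingTermAt_of_ratCharEqMultOdd_of_unitCoeff
    {W : WeierstrassCurve ℚ} [W.IsElliptic] [W.IsGloballyMinimal]
    (hmod : hasEntireLFunction_rat) (hmodD : nonempty_modularParametrizationData)
    (hX : ClassX3M W p) (hp4 : p % 4 = 3) (hMC : ChiBranchRatCharEqMultOddAt W p)
    (hcert : MultOddBranchUnitCoeffCert W p) : CycLowerLeadingTermAt W p := by
  obtain ⟨V, iV, iVm, C, hV, hC⟩ := hX.exists_mult_pStar_twist_model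
  haveI : NeZero (V.conductorNorm ℤ) := ⟨(V.conductorNorm_pos_holds).ne'⟩
  obtain ⟨Dm⟩ := hmodD V
  obtain ⟨ϖ, -, hϖ⟩ := exists_rat_mul_imaginaryPeriodRat_eq_minusPeriod Dm
  have hC' : C • V.quadraticTwist (-(p : ℚ)) = W := by
    rw [pStar_eq_of_mod_four p (Or.inr hp4), if_neg (by omega)] at hC
    exact hC
  by_cases hs : V.HasSplitMultiplicativeReductionAtPrime p
  · obtain ⟨hap, -⟩ := Dm.isNewformOf.cuspCoeff_eq_one_and_sq_of_split hs
    have hap' : cuspCoeff Dm.f p = ((1 : ℤ) : ℂ) := by exact_mod_cast hap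
    exact cycLowerLeadingTermAt_of_chiBranchRatCharEqMultOdd_of_unitCoeff W p hmod hp4 hX.1.2 V C hC'
      hV Dm.isNewformOf (Dm.isNewformOf.dvd_level_of_split hs) hap' (Or.inl rfl) ϖ hϖ hMC
      (hcert V C hV hC' Dm.f Dm.isNewformOf 1 hap' ϖ hϖ)
  · obtain ⟨hap, hpN⟩ := Dm.isNewformOf.cuspCoeff_eq_neg_one_and_dvd_of_nonsplit hV hs
    have hap' : cuspCoeff Dm.f p = ((-1 : ℤ) : ℂ) := by exact_mod_cast hap
    exact cycLowerLeadingTermAt_of_chiBranchRatCharEqMultOdd_of_unitCoeff W p hmod hp4 hX.1.2 V C hC'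
      hV Dm.isNewformOf hpN hap' (Or.inr rfl) ϖ hϖ hMC
      (hcert V C hV hC' Dm.f Dm.isNewformOf (-1) hap' ϖ hϖ)

/-- **X3♯(M) (reducible `E[p]`), `r_an = 0`, EVERY odd `p`: the LOWER half from (KV) + (BC) + the
unit-coefficient certificate**, over `hDelX`, `hPal` (`p ≡ 1 (4)` only), `hGZK`, `hmod`, `hmodD` and the
reading fact `hW16` (Wuthrich 2014 Thm. 16). Chain: §4 ⟹ `ChiBranchRatCharEqMult[Odd]At W p` ⟹
`CycLowerLeadingTermAt W p` (above) ⟹ `CycLeadingTermDvdAt` ⟹ `MissingLowerBoundAt` by n1011-p18's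
`ClassX3M.missingLowerBoundAt_rankZero_of_cycLeadingTermDvd`. NO image hypothesis. X3♯(M) stays
CONSTRUCTION-shaped; nothing booked. [cite: Delbourgo1998, Prop. 4 (p. 144), §2.2 Lemma (ii) (p. 139)]
[cite: Wuthrich2014, Thm. 16 (p. 397)] [cite: BurungaleCastellaSkinner2025, Thm. 1.1.2 (a) (shape)] -/
theorem ClassX3M.missingLowerBoundAt_rankZero_of_katoV_of_baseChangeLower_of_unitCoeff
    {W : WeierstrassCurve ℚ} [W.IsElliptic] [W.IsGloballyMinimal]
    (hDelX : Delbourgo1998.prop4_rankZero_constantCoeff_eq_unit_mul_of_potMult)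
    (hPal : Pal2012.thm32_sqrt_mul_realPeriodRat_twist_eq_of_prime_one_mod_four)
    (hGZK : rank_eq_analyticRank_of_analyticRank_le_one) (hmod : hasEntireLFunction_rat)
    (hmodD : nonempty_modularParametrizationData)
    (hW16 : Wuthrich2014.thm16_halfEigenCharIdeal_dvd_cyclotomicPrime)
    (hX : ClassX3M W p) (hr : W.analyticRank = 0)
    (hKV : ∀ (V : WeierstrassCurve ℚ) [V.IsElliptic] [V.IsGloballyMinimal] (C : VariableChange ℚ),
      Mult V p → C • V.quadraticTwist ((-1 : ℚ) ^ (p / 2) * p) = W →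
      ∀ {N : ℕ} [NeZero N] (f : CuspForm (Gamma0 N) 2), IsNewformOf V f →
      ∀ (ap : ℤ), cuspCoeff f p = ap →
      ∀ (κ : ZpExtension ℚ p) (γ : Field.absoluteGaloisGroup ℚ),
        κ.IsCyclotomic → κ.IsTopGenerator γ → IsCyclotomicVariable p γ →
      ∀ (DV : V.SelmerDualData κ γ) (L : PowerSeries ℚ_[p]),
        IsMultPAdicLFunctionOf f p ((ap : ℤ) : ℚ_[p]) L →
        ∃ (a : ℕ) (h : IwasawaAlgebra p), h ∈ DV.charIdeal ∧
          iwasawaToPowerSeries p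
              (PowerSeries.X ^ (if V.HasSplitMultiplicativeReductionAtPrime p then 1 else 0) * h) =
            PowerSeries.C ((p : ℚ_[p]) ^ a) * L)
    (hBC : ∀ (V : WeierstrassCurve ℚ) [V.IsElliptic] [V.IsGloballyMinimal] (C : VariableChange ℚ),
      Mult V p → C • V.quadraticTwist ((-1 : ℚ) ^ (p / 2) * p) = W →
      ∀ {N : ℕ} [NeZero N] (f : CuspForm (Gamma0 N) 2), IsNewformOf V f →
      ∀ (ap : ℤ), cuspCoeff f p = ap →
      ∀ (κ : ZpExtension ℚ p) (γ : Field.absoluteGaloisGroup ℚ),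
        κ.IsCyclotomic → κ.IsTopGenerator γ → IsCyclotomicVariable p γ →
      ∀ (DV : V.SelmerDualData κ γ) (D : W.SelmerDualData κ γ) (L : PowerSeries ℚ_[p]),
        IsMultPAdicLFunctionOf f p ((ap : ℤ) : ℚ_[p]) L →
        ∃ (m n : ℕ) (G : IwasawaAlgebra p),
          iwasawaToPowerSeries p
              (PowerSeries.X ^ (if V.HasSplitMultiplicativeReductionAtPrime p then 1 else 0) * G) =
            PowerSeries.C ((p : ℚ_[p]) ^ n) *
              (L * (if Even (p / 2) then padicLFunctionPlusBranchMult f ((ap : ℤ) : ℚ_[p]) (p / 2)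
                else padicLFunctionMinusBranchMult f ((ap : ℤ) : ℚ_[p]) (p / 2))) ∧
          ∀ x ∈ DV.charIdeal, ∀ y ∈ D.charIdeal,
            PowerSeries.C ((p : ℤ_[p]) ^ m) * (x * y) ∈ Ideal.span {G})
    (hcert₁ : p % 4 = 1 → MultBranchUnitCoeffCert W p)
    (hcert₃ : p % 4 = 3 → MultOddBranchUnitCoeffCert W p) : MissingLowerBoundAt W p := by
  obtain ⟨h1, h3⟩ := ClassX3M.chiBranchRatCharEqMult_of_katoV_of_baseChangeLower p hW16 hX hKV hBC
  have hodd : p % 4 = 1 ∨ p % 4 = 3 := by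
    obtain ⟨k, hk⟩ := hp.out.odd_of_ne_two (ClassX3M.p_ne_two W p hX)
    omega
  rcases hodd with h | h
  · exact hX.missingLowerBoundAt_rankZero_of_cycLeadingTermDvd hDelX hGZK hmod hr
      (cycLeadingTermDvdAt_of_cycLowerLeadingTermAt (W := W) (p := p)
        (ClassX3M.cycLowerLeadingTermAt_of_ratCharEqMult_of_unitCoeff p hPal hmod hmodD hX h (h1 h)
          (hcert₁ h)))
  · exact hX.missingLowerBoundAt_rankZero_of_cycLeadingTermDvd hDelX hGZK hmod hr
      (cycLeadingTermDvdAt_of_cycLowerLeadingTermAt (W := W) (p := p)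
        (ClassX3M.cycLowerLeadingTermAt_of_ratCharEqMultOdd_of_unitCoeff p hmod hmodD hX h (h3 h)
          (hcert₃ h)))

/-- **`stub_rankZero` at a pair of cell (M) with `ρ̄_{E,p}` reducible OR onto, MODULO (KV), (BC) and the
certificate.** `W` globally minimal, `p` odd additive potentially multiplicative (`N10.CellM W p`),
`r_an = 0`, and `Irr W p → Surj W p` (excludes only the irreducible NON-surjective rows, class O8 of the
residual map); published facts `hDelX`, `hPal`, `hGZK`, `hmod`, `hmodD`, `hK` (Kato 17.4 (3) reading),
`hW16` (Wuthrich Thm. 16 reading); displayed: (KV), (BC) and the unit-coefficient certificate of the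
parity. Then `MissingLowerBoundAt W p`. The X3♯(M)/X4(M) cases of §3 glued by
`N10.cellM_iff_classX3M_or_classX4M`. Conditional ((BC) not in print); nothing booked.
[cite: Delbourgo1998, Prop. 4 (p. 144), §2.2 Lemma (ii) (p. 139)] [cite: Kato2004Asterisque, Thm. 17.4 (3) (p. 273)]
[cite: Wuthrich2014, Thm. 16 (p. 397)] [cite: BurungaleCastellaSkinner2025, Thm. 1.1.2 (a) (shape)] -/
theorem missingLowerBoundAt_rankZero_of_cellM_of_katoV_of_baseChangeLower
    {W : WeierstrassCurve ℚ} [W.IsElliptic] [W.IsGloballyMinimal]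
    (hDelX : Delbourgo1998.prop4_rankZero_constantCoeff_eq_unit_mul_of_potMult)
    (hPal : Pal2012.thm32_sqrt_mul_realPeriodRat_twist_eq_of_prime_one_mod_four)
    (hGZK : rank_eq_analyticRank_of_analyticRank_le_one) (hmod : hasEntireLFunction_rat)
    (hmodD : nonempty_modularParametrizationData)
    (hK : Wuthrich2014.kato_halfEigenCharIdeal_dvd_cyclotomicPrime_of_surjective)
    (hW16 : Wuthrich2014.thm16_halfEigenCharIdeal_dvd_cyclotomicPrime)
    (hc : N10.CellM W p) (hr : W.analyticRank = 0) (himg : Irr W p → Surj W p)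
    (hKV : ∀ (V : WeierstrassCurve ℚ) [V.IsElliptic] [V.IsGloballyMinimal] (C : VariableChange ℚ),
      Mult V p → C • V.quadraticTwist ((-1 : ℚ) ^ (p / 2) * p) = W →
      ∀ {N : ℕ} [NeZero N] (f : CuspForm (Gamma0 N) 2), IsNewformOf V f →
      ∀ (ap : ℤ), cuspCoeff f p = ap →
      ∀ (κ : ZpExtension ℚ p) (γ : Field.absoluteGaloisGroup ℚ),
        κ.IsCyclotomic → κ.IsTopGenerator γ → IsCyclotomicVariable p γ →
      ∀ (DV : V.SelmerDualData κ γ) (L : PowerSeries ℚ_[p]),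
        IsMultPAdicLFunctionOf f p ((ap : ℤ) : ℚ_[p]) L →
        ∃ (a : ℕ) (h : IwasawaAlgebra p), h ∈ DV.charIdeal ∧
          iwasawaToPowerSeries p
              (PowerSeries.X ^ (if V.HasSplitMultiplicativeReductionAtPrime p then 1 else 0) * h) =
            PowerSeries.C ((p : ℚ_[p]) ^ a) * L)
    (hBC : ∀ (V : WeierstrassCurve ℚ) [V.IsElliptic] [V.IsGloballyMinimal] (C : VariableChange ℚ),
      Mult V p → C • V.quadraticTwist ((-1 : ℚ) ^ (p / 2) * p) = W →
      ∀ {N : ℕ} [NeZero N] (f : CuspForm (Gamma0 N) 2), IsNewformOf V f →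
      ∀ (ap : ℤ), cuspCoeff f p = ap →
      ∀ (κ : ZpExtension ℚ p) (γ : Field.absoluteGaloisGroup ℚ),
        κ.IsCyclotomic → κ.IsTopGenerator γ → IsCyclotomicVariable p γ →
      ∀ (DV : V.SelmerDualData κ γ) (D : W.SelmerDualData κ γ) (L : PowerSeries ℚ_[p]),
        IsMultPAdicLFunctionOf f p ((ap : ℤ) : ℚ_[p]) L →
        ∃ (m n : ℕ) (G : IwasawaAlgebra p),
          iwasawaToPowerSeries p
              (PowerSeries.X ^ (if V.HasSplitMultiplicativeReductionAtPrime p then 1 else 0) * G) =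
            PowerSeries.C ((p : ℚ_[p]) ^ n) *
              (L * (if Even (p / 2) then padicLFunctionPlusBranchMult f ((ap : ℤ) : ℚ_[p]) (p / 2)
                else padicLFunctionMinusBranchMult f ((ap : ℤ) : ℚ_[p]) (p / 2))) ∧
          ∀ x ∈ DV.charIdeal, ∀ y ∈ D.charIdeal,
            PowerSeries.C ((p : ℤ_[p]) ^ m) * (x * y) ∈ Ideal.span {G})
    (hcert₁ : p % 4 = 1 → MultBranchUnitCoeffCert W p)
    (hcert₃ : p % 4 = 3 → MultOddBranchUnitCoeffCert W p) : MissingLowerBoundAt W p := by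
  rcases (N10.cellM_iff_classX3M_or_classX4M W p).mp hc with hX | hX
  · exact ClassX3M.missingLowerBoundAt_rankZero_of_katoV_of_baseChangeLower_of_unitCoeff p hDelX hPal hGZK
      hmod hmodD hW16 hX hr hKV hBC hcert₁ hcert₃
  · exact ClassX4M.missingLowerBoundAt_rankZero_of_katoV_of_baseChangeLower_of_unitCoeff p hDelX hPal hGZK
      hmod hmodD hK hX (himg hX.1.2.2) hr hKV hBC hcert₁ hcert₃

end Summit.BirchSwinnertonDyer.BirchSwinnertonDyer.Theorems.AdditiveBranchIMCMultLower

end
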